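import Summits.CriticalPhenomena.PercolationContinuityZ3.Theorems.PercAnnulusCrossingIICVolumeExponentDeterministic
import Mathlib.Analysis.SpecialFunctions.Pow.Asymptotics
import HarnessLib

/-!
# The rate constants of Kesten's IIC at non-critical power scales are trivial: the exponent phase diagram (lane RSW3, p1 gen 14)

builds on p205010 (kernel theorem, internal audit signed; external expert review pending) — only through the imported gen 14 files
(`θ(p_c) = 0` is not used here beyond them); the statements below hold for every IIC measure with `θ(p) = 0` under (A2)□.

Seat `prim-rsw3-p1` (gen 14); memo `run/shared/lean/prim/rsw3/P1-QM.md` §27.  Helper file for the crux `stmt-CriticalPhenomena-4575`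
chain; no definitions, no sorries.

Gen 14 proved that for every power scale `σ_n = (n+2)^α` the rates `limsup/liminf D_n/σ_n`, `V_n/σ_n` of the IIC are a.s. constant
(`…IICChemicalDistanceDeterministic`, `…IICVolumeGrowthDeterministic`) and that the exponents `α^± = limsup/liminf log D_n/log(n+2)`,
`β^±` likewise, are a.s. constant (`…IICChemicalExponentDeterministic`, `…IICVolumeExponentDeterministic`).  This file links the two:

* generic sequence lemmas (`a : ℕ → ℕ`, exponent sequence `e_n = log a_n / log(n+2)`, rate `a_n/(n+2)^α`, `α > 0`):
  `natCast_le_rpow_of_log_div_lt`, `rpow_le_natCast_of_lt_log_div`; **`limsup_div_rpow_eq_zero_of_limsup_log_lt`** (`limsup e < α ⇒ limsup rate = 0`),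
  **`limsup_div_rpow_eq_top_of_lt_limsup_log`** (`α < limsup e ⇒ limsup rate = ∞`), **`liminf_div_rpow_eq_zero_of_liminf_log_lt`**,
  **`liminf_div_rpow_eq_top_of_lt_liminf_log`**;
* **`iicMeasure_chemical_rate_phase_diagram`** (`θ(p) = 0`, (A2)□, `2 ≤ s`) — with the deterministic chemical exponents `α⁻ ≤ α⁺`: for every `α > 0`,
  `ν`-a.s. `limsup_n D_n/(n+2)^α = 0` if `α⁺ < α` and `= ∞` if `α < α⁺`; `liminf_n D_n/(n+2)^α = 0` if `α⁻ < α` and `= ∞` if `α < α⁻` —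
  **the a.s. rate constants of gen 14 are trivial (0 or ∞) at every non-critical power scale; the only informative scales are `(n+2)^{α^±}`**;
* **`iicMeasure_volume_rate_phase_diagram`** — the same for `V_n` and `β^±`.

References: H. Kesten, PTRF 73 (1986); H.-O. Georgii (2011), Prop. 7.9.
-/

noncomputable section

namespace Summit.CriticalPhenomena.PercolationContinuityZ3.Theorems.Crossing

open MeasureTheory Filter Topology Literature.Probability.Percolation Literature.Probability.LatticeModels
open Literature.Probability.Percolation.DCT16 Literature.Probability.Percolation.DKT20
open Summit.CriticalPhenomena.PercolationContinuityZ3.Theorems.SurfaceTension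
open scoped Literature.Probability.Percolation ENNReal symmDiff

variable {d : ℕ}

/-! ## Generic sequence lemmas -/

/-- `log a / log(n+2) < α'` ⇒ `a ≤ (n+2)^{α'}` (naturals `a`; reals `n + 2 > 1`). [folklore] -/
theorem natCast_le_rpow_of_log_div_lt (a n : ℕ) {α' : ℝ} (h : Real.log (a : ℝ) / Real.log ((n : ℝ) + 2) < α') :
    (a : ℝ) ≤ ((n : ℝ) + 2) ^ α' := by
  have h2 : 0 < Real.log ((n : ℝ) + 2) := Real.log_pos (by linarith [(Nat.cast_nonneg n : (0 : ℝ) ≤ n)])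
  have hn2 : (0 : ℝ) < (n : ℝ) + 2 := by positivity
  rcases Nat.eq_zero_or_pos a with h0 | hpos
  · rw [h0, Nat.cast_zero]; positivity
  · have hlt : Real.log (a : ℝ) < α' * Real.log ((n : ℝ) + 2) := (div_lt_iff₀ h2).1 h
    exact ((Real.le_rpow_iff_log_le (by exact_mod_cast hpos) hn2).2 hlt.le)

/-- `α' < log a / log(n+2)` ⇒ `(n+2)^{α'} ≤ a` (naturals `a`, `0 ≤ α'`). [folklore] -/
theorem rpow_le_natCast_of_lt_log_div (a n : ℕ) {α' : ℝ} (hα' : 0 ≤ α') (h : α' < Real.log (a : ℝ) / Real.log ((n : ℝ) + 2)) :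
    ((n : ℝ) + 2) ^ α' ≤ (a : ℝ) := by
  have h2 : 0 < Real.log ((n : ℝ) + 2) := Real.log_pos (by linarith [(Nat.cast_nonneg n : (0 : ℝ) ≤ n)])
  have hn2 : (0 : ℝ) < (n : ℝ) + 2 := by positivity
  rcases Nat.eq_zero_or_pos a with h0 | hpos
  · exfalso
    rw [h0, Nat.cast_zero, Real.log_zero, zero_div] at h
    linarith
  · have hlt : α' * Real.log ((n : ℝ) + 2) < Real.log (a : ℝ) := (lt_div_iff₀ h2).1 h
    exact (Real.rpow_le_iff_le_log hn2 (by exact_mod_cast hpos)).2 hlt.le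

/-- **Exponent below the scale ⇒ vanishing rate**: if `limsup_n log a_n / log(n+2) < α` then `limsup_n a_n/(n+2)^α = 0`. [folklore] -/
theorem limsup_div_rpow_eq_zero_of_limsup_log_lt (a : ℕ → ℕ) {α : ℝ}
    (h : limsup (fun n => ENNReal.ofReal (Real.log (a n : ℝ) / Real.log ((n : ℝ) + 2))) atTop < ENNReal.ofReal α) :
    limsup (fun n => ENNReal.ofReal ((a n : ℝ) / ((n : ℝ) + 2) ^ α)) atTop = 0 := by
  set E := limsup (fun n => ENNReal.ofReal (Real.log (a n : ℝ) / Real.log ((n : ℝ) + 2))) atTop with hE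
  have hEtop : E ≠ ⊤ := ne_top_of_lt h
  have hEα : E.toReal < α := ENNReal.toReal_lt_of_lt_ofReal h
  set α' : ℝ := (E.toReal + α) / 2 with hα'
  have hα'α : α' < α := by rw [hα']; linarith
  have h1 : E < ENNReal.ofReal α' := by
    rw [ENNReal.lt_ofReal_iff_toReal_lt hEtop]; rw [hα']; linarith
  have hev : ∀ᶠ n : ℕ in atTop, ENNReal.ofReal (Real.log (a n : ℝ) / Real.log ((n : ℝ) + 2)) < ENNReal.ofReal α' :=
    eventually_lt_of_limsup_lt h1
  have hev2 : ∀ᶠ n : ℕ in atTop, ENNReal.ofReal ((a n : ℝ) / ((n : ℝ) + 2) ^ α) ≤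
      ENNReal.ofReal ((((n : ℕ) : ℝ) + 2) ^ (-(α - α'))) := hev.mono fun n hn => by
    have hn2 : (0 : ℝ) < (n : ℝ) + 2 := by positivity
    have he : Real.log (a n : ℝ) / Real.log ((n : ℝ) + 2) < α' := by
      have h' := ENNReal.toReal_lt_of_lt_ofReal hn
      rwa [ENNReal.toReal_ofReal (div_nonneg (Real.log_natCast_nonneg _)
        (Real.log_pos (by linarith [(Nat.cast_nonneg n : (0 : ℝ) ≤ n)])).le)] at h'
    have ha : (a n : ℝ) ≤ ((n : ℝ) + 2) ^ α' := natCast_le_rpow_of_log_div_lt (a n) n he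
    refine ENNReal.ofReal_le_ofReal ?_
    rw [div_le_iff₀ (by positivity), ← Real.rpow_add hn2, show -(α - α') + α = α' by ring]
    exact ha
  have hlim : Tendsto (fun n : ℕ => ENNReal.ofReal ((((n : ℕ) : ℝ) + 2) ^ (-(α - α')))) atTop (𝓝 0) := by
    rw [← ENNReal.ofReal_zero]
    exact ENNReal.tendsto_ofReal ((tendsto_rpow_neg_atTop (by linarith : 0 < α - α')).comp
      (tendsto_atTop_add_const_right _ _ tendsto_natCast_atTop_atTop))
  exact le_antisymm ((limsup_le_limsup hev2).trans hlim.limsup_eq.le) bot_le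

/-- **Exponent above the scale ⇒ exploding rate**: if `α < limsup_n log a_n / log(n+2)` (`α > 0`) then `limsup_n a_n/(n+2)^α = ∞`. [folklore] -/
theorem limsup_div_rpow_eq_top_of_lt_limsup_log (a : ℕ → ℕ) {α : ℝ} (hα : 0 < α)
    (h : ENNReal.ofReal α < limsup (fun n => ENNReal.ofReal (Real.log (a n : ℝ) / Real.log ((n : ℝ) + 2))) atTop) :
    limsup (fun n => ENNReal.ofReal ((a n : ℝ) / ((n : ℝ) + 2) ^ α)) atTop = ⊤ := by
  set E := limsup (fun n => ENNReal.ofReal (Real.log (a n : ℝ) / Real.log ((n : ℝ) + 2))) atTop with hE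
  -- an intermediate exponent `α < α'` with `ofReal α' < E`
  obtain ⟨α', hαα', hα'E⟩ : ∃ α' : ℝ, α < α' ∧ ENNReal.ofReal α' < E := by
    by_cases hEtop : E = ⊤
    · exact ⟨α + 1, by linarith, by rw [hEtop]; exact ENNReal.ofReal_lt_top⟩
    · have hEα : α < E.toReal := (ENNReal.ofReal_lt_iff_lt_toReal hα.le hEtop).1 h
      refine ⟨(α + E.toReal) / 2, by linarith, ?_⟩
      rw [ENNReal.ofReal_lt_iff_lt_toReal (by linarith) hEtop]; linarith
  have hα'0 : 0 ≤ α' := by linarith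
  have hfreq : ∃ᶠ n : ℕ in atTop, ENNReal.ofReal α' < ENNReal.ofReal (Real.log (a n : ℝ) / Real.log ((n : ℝ) + 2)) :=
    frequently_lt_of_lt_limsup (by isBoundedDefault) hα'E
  have hfreq2 : ∃ᶠ n : ℕ in atTop, ENNReal.ofReal ((((n : ℕ) : ℝ) + 2) ^ (α' - α)) ≤
      ENNReal.ofReal ((a n : ℝ) / ((n : ℝ) + 2) ^ α) := hfreq.mono fun n hn => by
    have hn2 : (0 : ℝ) < (n : ℝ) + 2 := by positivity
    have he : α' < Real.log (a n : ℝ) / Real.log ((n : ℝ) + 2) := (ENNReal.ofReal_lt_ofReal_iff_of_nonneg hα'0).1 hn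
    have ha : ((n : ℝ) + 2) ^ α' ≤ (a n : ℝ) := rpow_le_natCast_of_lt_log_div (a n) n hα'0 he
    refine ENNReal.ofReal_le_ofReal ?_
    rw [le_div_iff₀ (by positivity), ← Real.rpow_add hn2, sub_add_cancel]
    exact ha
  have hlim : Tendsto (fun n : ℕ => (((n : ℕ) : ℝ) + 2) ^ (α' - α)) atTop atTop :=
    (tendsto_rpow_atTop (by linarith : 0 < α' - α)).comp (tendsto_atTop_add_const_right _ _ tendsto_natCast_atTop_atTop)
  refine ENNReal.eq_top_of_forall_nnreal_le fun M => ?_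
  refine le_limsup_of_frequently_le ?_ (by isBoundedDefault)
  refine (hfreq2.and_eventually (hlim.eventually_ge_atTop (M : ℝ))).mono fun n hn => ?_
  calc (M : ℝ≥0∞) = ENNReal.ofReal (M : ℝ) := (ENNReal.ofReal_coe_nnreal).symm
    _ ≤ ENNReal.ofReal ((((n : ℕ) : ℝ) + 2) ^ (α' - α)) := ENNReal.ofReal_le_ofReal hn.2
    _ ≤ _ := hn.1

/-- **Lower exponent below the scale ⇒ the lower rate vanishes**: `liminf_n log a_n/log(n+2) < α ⇒ liminf_n a_n/(n+2)^α = 0`. [folklore] -/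
theorem liminf_div_rpow_eq_zero_of_liminf_log_lt (a : ℕ → ℕ) {α : ℝ}
    (h : liminf (fun n => ENNReal.ofReal (Real.log (a n : ℝ) / Real.log ((n : ℝ) + 2))) atTop < ENNReal.ofReal α) :
    liminf (fun n => ENNReal.ofReal ((a n : ℝ) / ((n : ℝ) + 2) ^ α)) atTop = 0 := by
  set E := liminf (fun n => ENNReal.ofReal (Real.log (a n : ℝ) / Real.log ((n : ℝ) + 2))) atTop with hE
  have hEtop : E ≠ ⊤ := ne_top_of_lt h
  have hEα : E.toReal < α := ENNReal.toReal_lt_of_lt_ofReal h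
  set α' : ℝ := (E.toReal + α) / 2 with hα'
  have hα'α : α' < α := by rw [hα']; linarith
  have h1 : E < ENNReal.ofReal α' := by
    rw [ENNReal.lt_ofReal_iff_toReal_lt hEtop]; rw [hα']; linarith
  have hfreq : ∃ᶠ n : ℕ in atTop, ENNReal.ofReal (Real.log (a n : ℝ) / Real.log ((n : ℝ) + 2)) < ENNReal.ofReal α' :=
    frequently_lt_of_liminf_lt (by isBoundedDefault) h1
  have hfreq2 : ∃ᶠ n : ℕ in atTop, ENNReal.ofReal ((a n : ℝ) / ((n : ℝ) + 2) ^ α) ≤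
      ENNReal.ofReal ((((n : ℕ) : ℝ) + 2) ^ (-(α - α'))) := hfreq.mono fun n hn => by
    have hn2 : (0 : ℝ) < (n : ℝ) + 2 := by positivity
    have he : Real.log (a n : ℝ) / Real.log ((n : ℝ) + 2) < α' := by
      have h' := ENNReal.toReal_lt_of_lt_ofReal hn
      rwa [ENNReal.toReal_ofReal (div_nonneg (Real.log_natCast_nonneg _)
        (Real.log_pos (by linarith [(Nat.cast_nonneg n : (0 : ℝ) ≤ n)])).le)] at h'
    have ha : (a n : ℝ) ≤ ((n : ℝ) + 2) ^ α' := natCast_le_rpow_of_log_div_lt (a n) n he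
    refine ENNReal.ofReal_le_ofReal ?_
    rw [div_le_iff₀ (by positivity), ← Real.rpow_add hn2, show -(α - α') + α = α' by ring]
    exact ha
  have hlim : Tendsto (fun n : ℕ => (((n : ℕ) : ℝ) + 2) ^ (-(α - α'))) atTop (𝓝 0) :=
    (tendsto_rpow_neg_atTop (by linarith : 0 < α - α')).comp (tendsto_atTop_add_const_right _ _ tendsto_natCast_atTop_atTop)
  refine le_antisymm (ENNReal.le_of_forall_pos_le_add fun ε hε _ => ?_) bot_le
  rw [zero_add]
  refine liminf_le_of_frequently_le ?_ (by isBoundedDefault)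
  have hev : ∀ᶠ n : ℕ in atTop, (((n : ℕ) : ℝ) + 2) ^ (-(α - α')) ≤ (ε : ℝ) :=
    (hlim.eventually (ge_mem_nhds (by exact_mod_cast hε))).mono fun n hn => hn
  refine (hfreq2.and_eventually hev).mono fun n hn => hn.1.trans ?_
  calc ENNReal.ofReal ((((n : ℕ) : ℝ) + 2) ^ (-(α - α'))) ≤ ENNReal.ofReal (ε : ℝ) := ENNReal.ofReal_le_ofReal hn.2
    _ = ε := ENNReal.ofReal_coe_nnreal

/-- **Lower exponent above the scale ⇒ the lower rate explodes**: `α < liminf_n log a_n/log(n+2)` (`α > 0`) ⇒ `liminf_n a_n/(n+2)^α = ∞`. [folklore] -/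
theorem liminf_div_rpow_eq_top_of_lt_liminf_log (a : ℕ → ℕ) {α : ℝ} (hα : 0 < α)
    (h : ENNReal.ofReal α < liminf (fun n => ENNReal.ofReal (Real.log (a n : ℝ) / Real.log ((n : ℝ) + 2))) atTop) :
    liminf (fun n => ENNReal.ofReal ((a n : ℝ) / ((n : ℝ) + 2) ^ α)) atTop = ⊤ := by
  set E := liminf (fun n => ENNReal.ofReal (Real.log (a n : ℝ) / Real.log ((n : ℝ) + 2))) atTop with hE
  obtain ⟨α', hαα', hα'E⟩ : ∃ α' : ℝ, α < α' ∧ ENNReal.ofReal α' < E := by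
    by_cases hEtop : E = ⊤
    · exact ⟨α + 1, by linarith, by rw [hEtop]; exact ENNReal.ofReal_lt_top⟩
    · have hEα : α < E.toReal := (ENNReal.ofReal_lt_iff_lt_toReal hα.le hEtop).1 h
      refine ⟨(α + E.toReal) / 2, by linarith, ?_⟩
      rw [ENNReal.ofReal_lt_iff_lt_toReal (by linarith) hEtop]; linarith
  have hα'0 : 0 ≤ α' := by linarith
  have hev : ∀ᶠ n : ℕ in atTop, ENNReal.ofReal α' < ENNReal.ofReal (Real.log (a n : ℝ) / Real.log ((n : ℝ) + 2)) :=
    eventually_lt_of_lt_liminf hα'E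
  have hev2 : ∀ᶠ n : ℕ in atTop, ENNReal.ofReal ((((n : ℕ) : ℝ) + 2) ^ (α' - α)) ≤
      ENNReal.ofReal ((a n : ℝ) / ((n : ℝ) + 2) ^ α) := hev.mono fun n hn => by
    have hn2 : (0 : ℝ) < (n : ℝ) + 2 := by positivity
    have he : α' < Real.log (a n : ℝ) / Real.log ((n : ℝ) + 2) := (ENNReal.ofReal_lt_ofReal_iff_of_nonneg hα'0).1 hn
    have ha : ((n : ℝ) + 2) ^ α' ≤ (a n : ℝ) := rpow_le_natCast_of_lt_log_div (a n) n hα'0 he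
    refine ENNReal.ofReal_le_ofReal ?_
    rw [le_div_iff₀ (by positivity), ← Real.rpow_add hn2, sub_add_cancel]
    exact ha
  have hlim : Tendsto (fun n : ℕ => ENNReal.ofReal ((((n : ℕ) : ℝ) + 2) ^ (α' - α))) atTop (𝓝 ⊤) :=
    ENNReal.tendsto_ofReal_atTop.comp
      ((tendsto_rpow_atTop (by linarith : 0 < α' - α)).comp (tendsto_atTop_add_const_right _ _ tendsto_natCast_atTop_atTop))
  exact top_unique (hlim.liminf_eq.symm.le.trans (liminf_le_liminf hev2))

/-! ## The phase diagrams -/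

/-- **THE CHEMICAL-RATE PHASE DIAGRAM OF KESTEN'S IIC** (`θ(p) = 0`, (A2)□ at aspect `(s,L)`, `2 ≤ s`): with the deterministic chemical exponents
`α⁻, α⁺` (`liminf/limsup_n log D_n/log(n+2)`, a.s. constant), for every power scale `α > 0`: `ν`-a.s. `limsup_n D_n/(n+2)^α = 0` if `α⁺ < α`,
`= ∞` if `α < α⁺`; `liminf_n D_n/(n+2)^α = 0` if `α⁻ < α`, `= ∞` if `α < α⁻` — gen 14's a.s. rate constants are `0` or `∞` off the critical scales.
[cite: Kesten1986, Thm. (3)] [cite: Georgii2011, Prop. 7.9] -/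
theorem iicMeasure_chemical_rate_phase_diagram (hd : 1 ≤ d) (p : unitInterval) (hp : 0 < (p : ℝ))
    (hθ : theta (zdGraph d) 0 p = 0) {s L : ℕ} (hs : 2 ≤ s) {ϰ : ℝ} (hϰ : 0 < ϰ) (hA2 : SetToSetQuasiMultAspectAt d p s L ϰ)
    {ν : Measure (BondConfig (Site d))} [IsProbabilityMeasure ν]
    (hν : ∀ (F : Finset (Sym2 (Site d))) (E : Set (BondConfig (Site d))), MeasurableSet E → DeterminedBy E ↑F →
      Tendsto (fun n : ℕ => (bondPercolation (zdGraph d) p).real (E ∩ siteToBoundary d n) / oneArmProb d p n)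
        atTop (𝓝 (ν.real E))) :
    ∃ αl αu : ℝ≥0∞, (∀ᵐ ω ∂ν,
      liminf (fun n => ENNReal.ofReal
        (Real.log (((⨅ v : {v : Site d // v ∉ box d n}, (openGraph ω).edist (0 : Site d) v.1).toNat : ℕ) : ℝ) /
          Real.log ((n : ℝ) + 2))) atTop = αl ∧
      limsup (fun n => ENNReal.ofReal
        (Real.log (((⨅ v : {v : Site d // v ∉ box d n}, (openGraph ω).edist (0 : Site d) v.1).toNat : ℕ) : ℝ) /
          Real.log ((n : ℝ) + 2))) atTop = αu) ∧
    ∀ α : ℝ, 0 < α →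
      (αu < ENNReal.ofReal α → ∀ᵐ ω ∂ν, limsup (fun n => ENNReal.ofReal
        ((((⨅ v : {v : Site d // v ∉ box d n}, (openGraph ω).edist (0 : Site d) v.1).toNat : ℕ) : ℝ) / ((n : ℝ) + 2) ^ α)) atTop = 0) ∧
      (ENNReal.ofReal α < αu → ∀ᵐ ω ∂ν, limsup (fun n => ENNReal.ofReal
        ((((⨅ v : {v : Site d // v ∉ box d n}, (openGraph ω).edist (0 : Site d) v.1).toNat : ℕ) : ℝ) / ((n : ℝ) + 2) ^ α)) atTop = ⊤) ∧
      (αl < ENNReal.ofReal α → ∀ᵐ ω ∂ν, liminf (fun n => ENNReal.ofReal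
        ((((⨅ v : {v : Site d // v ∉ box d n}, (openGraph ω).edist (0 : Site d) v.1).toNat : ℕ) : ℝ) / ((n : ℝ) + 2) ^ α)) atTop = 0) ∧
      (ENNReal.ofReal α < αl → ∀ᵐ ω ∂ν, liminf (fun n => ENNReal.ofReal
        ((((⨅ v : {v : Site d // v ∉ box d n}, (openGraph ω).edist (0 : Site d) v.1).toNat : ℕ) : ℝ) / ((n : ℝ) + 2) ^ α)) atTop = ⊤) := by
  obtain ⟨⟨αu, hu⟩, αl, hl⟩ := iicMeasure_exists_ae_chemical_exponents_eq_const hd p hp hθ hs hϰ hA2 hν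
  refine ⟨αl, αu, ?_, fun α hα => ⟨fun h => ?_, fun h => ?_, fun h => ?_, fun h => ?_⟩⟩
  · filter_upwards [hl, hu] with ω h1 h2; exact ⟨h1, h2⟩
  · filter_upwards [hu] with ω hω
    exact limsup_div_rpow_eq_zero_of_limsup_log_lt _ (hω.symm ▸ h)
  · filter_upwards [hu] with ω hω
    exact limsup_div_rpow_eq_top_of_lt_limsup_log _ hα (hω.symm ▸ h)
  · filter_upwards [hl] with ω hω
    exact liminf_div_rpow_eq_zero_of_liminf_log_lt _ (hω.symm ▸ h)
  · filter_upwards [hl] with ω hω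
    exact liminf_div_rpow_eq_top_of_lt_liminf_log _ hα (hω.symm ▸ h)

open Classical in
/-- **THE VOLUME-RATE PHASE DIAGRAM OF KESTEN'S IIC** (`θ(p) = 0`, (A2)□, `2 ≤ s`): with the deterministic volume exponents `β⁻, β⁺`, for every
`α > 0`: `ν`-a.s. `limsup_n V_n/(n+2)^α = 0` if `β⁺ < α`, `= ∞` if `α < β⁺`; `liminf_n V_n/(n+2)^α = 0` if `β⁻ < α`, `= ∞` if `α < β⁻`.
[cite: Kesten1986, Thm. (8)] [cite: Georgii2011, Prop. 7.9] -/
theorem iicMeasure_volume_rate_phase_diagram (hd : 1 ≤ d) (p : unitInterval) (hp : 0 < (p : ℝ))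
    (hθ : theta (zdGraph d) 0 p = 0) {s L : ℕ} (hs : 2 ≤ s) {ϰ : ℝ} (hϰ : 0 < ϰ) (hA2 : SetToSetQuasiMultAspectAt d p s L ϰ)
    {ν : Measure (BondConfig (Site d))} [IsProbabilityMeasure ν]
    (hν : ∀ (F : Finset (Sym2 (Site d))) (E : Set (BondConfig (Site d))), MeasurableSet E → DeterminedBy E ↑F →
      Tendsto (fun n : ℕ => (bondPercolation (zdGraph d) p).real (E ∩ siteToBoundary d n) / oneArmProb d p n)
        atTop (𝓝 (ν.real E))) :
    ∃ βl βu : ℝ≥0∞, (∀ᵐ ω ∂ν,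
      liminf (fun n => ENNReal.ofReal
        (Real.log ((((box d n).filter fun z => ω ∈ (openConn (0 : Site d) z : Set (BondConfig (Site d)))).card : ℕ) : ℝ) /
          Real.log ((n : ℝ) + 2))) atTop = βl ∧
      limsup (fun n => ENNReal.ofReal
        (Real.log ((((box d n).filter fun z => ω ∈ (openConn (0 : Site d) z : Set (BondConfig (Site d)))).card : ℕ) : ℝ) /
          Real.log ((n : ℝ) + 2))) atTop = βu) ∧
    ∀ α : ℝ, 0 < α →
      (βu < ENNReal.ofReal α → ∀ᵐ ω ∂ν, limsup (fun n => ENNReal.ofReal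
        (((((box d n).filter fun z => ω ∈ (openConn (0 : Site d) z : Set (BondConfig (Site d)))).card : ℕ) : ℝ) /
          ((n : ℝ) + 2) ^ α)) atTop = 0) ∧
      (ENNReal.ofReal α < βu → ∀ᵐ ω ∂ν, limsup (fun n => ENNReal.ofReal
        (((((box d n).filter fun z => ω ∈ (openConn (0 : Site d) z : Set (BondConfig (Site d)))).card : ℕ) : ℝ) /
          ((n : ℝ) + 2) ^ α)) atTop = ⊤) ∧
      (βl < ENNReal.ofReal α → ∀ᵐ ω ∂ν, liminf (fun n => ENNReal.ofReal
        (((((box d n).filter fun z => ω ∈ (openConn (0 : Site d) z : Set (BondConfig (Site d)))).card : ℕ) : ℝ) /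
          ((n : ℝ) + 2) ^ α)) atTop = 0) ∧
      (ENNReal.ofReal α < βl → ∀ᵐ ω ∂ν, liminf (fun n => ENNReal.ofReal
        (((((box d n).filter fun z => ω ∈ (openConn (0 : Site d) z : Set (BondConfig (Site d)))).card : ℕ) : ℝ) /
          ((n : ℝ) + 2) ^ α)) atTop = ⊤) := by
  obtain ⟨⟨βu, hu⟩, βl, hl⟩ := iicMeasure_exists_ae_volume_exponents_eq_const hd p hp hθ hs hϰ hA2 hν
  refine ⟨βl, βu, ?_, fun α hα => ⟨fun h => ?_, fun h => ?_, fun h => ?_, fun h => ?_⟩⟩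
  · filter_upwards [hl, hu] with ω h1 h2; exact ⟨h1, h2⟩
  · filter_upwards [hu] with ω hω
    exact limsup_div_rpow_eq_zero_of_limsup_log_lt _ (hω.symm ▸ h)
  · filter_upwards [hu] with ω hω
    exact limsup_div_rpow_eq_top_of_lt_limsup_log _ hα (hω.symm ▸ h)
  · filter_upwards [hl] with ω hω
    exact liminf_div_rpow_eq_zero_of_liminf_log_lt _ (hω.symm ▸ h)
  · filter_upwards [hl] with ω hω
    exact liminf_div_rpow_eq_top_of_lt_liminf_log _ hα (hω.symm ▸ h)

end Summit.CriticalPhenomena.PercolationContinuityZ3.Theorems.Crossing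

end
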